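import Summits.NavierStokesRegularity.FluidComputer.RotorKnobFire
import HarnessLib

/-!
# The seed–rotor scale knob, part 5 of 6: the equipartition energy, (toke), (beable)

Part 5 of `RotorKnob*.lean` (cell `pub-fluidc`, blueprint seat bp1, gen 22; namespace
`Summit.NavierStokesRegularity.FluidComputer.RotorKnob`).
HONEST FRAMING: low prior, high value-of-information experiment on Tao's machine paradigm; NOT a
claim that NS blows up.
Five-mode ODE analysis of [Tao2016AveragedNS, §5.5] with the clock/amplifier scale `ε` and the
seed/rotor scale `ρ` kept apart; nothing is proved about Navier–Stokes.

THIS FILE: the modified energy `E_* = ½(1-ã²) - ½K·V·ã` (`hasDerivAt_Es`) and its dissipation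
inequality `Es_dissipation` (`∂ₜE_* + Kã(t')E_* ≤ 7K⁻⁸⁹` on `[t', 2]`, `t' = τ + δ + 1/K`);
`KVe_small` (`|½K·V·ã| ≤ ½K⁻⁹⁹`); (toke) `Es_decay` (`E_* ≤ e^{(1-√K)/10} + 70K⁻⁹⁰` from
`τ + δ + 1/√K` on); (beable) `ad_small_late` (`a² + d² ≤ 142K⁻²⁰`) and `late_sum_sq`
(`a²+b²+c²+d² ≤ 143K⁻²⁰`). The seed–rotor scale `ρ` enters only through the levels `K⁻¹⁰ρ²`,
`K¹⁰⁰ρ²` and `ρ² ≤ ε`. [cite: Tao2016AveragedNS, §5.5 (douse), (toke), (beable)].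
No named facts; 0 sorry.
-/

noncomputable section

namespace Summit.NavierStokesRegularity.FluidComputer.RotorKnob

open Set Real Filter
open _root_.Topology
open Literature.Analysis.FluidPDE.Tao2016AveragedNS
open Literature.Analysis.FluidPDE.Tao2016AveragedNS.Thm53 (antitoneOn_intFactor monotoneOn_intFactor
  antitoneOn_sub_of_deriv_le monotoneOn_sub_of_le_deriv exists_hitTime abs_sub_le_of_abs_deriv_le
  sqrt_two_gt sqrt_two_lt invSqrt_facts Es_alg decay_alg numeric_N4 init_a init_b init_c init_d
  init_e)

variable {K M ε ρ τ δ : ℝ} {X : ℝ → Fin 5 → ℝ}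

/-! ## Equipartition energy `E_*` and its decay (toke) -/

/-- Derivative of the modified energy `E_* = ½(1-ã²) - ½K·(adρ²/c)·ã` (`= ½(a²+b²+c²+d²) - …` by
(energy-con)): `∂ₜE_* = -½Kã(a²+d²) - ½K·R·ã - ½K²·V·d²`, with `R` the remainder of `∂ₜV`.
[cite: Tao2016AveragedNS, §5.5 (proof of (beable))] -/
theorem hasDerivAt_Es (hX : ∀ t, HasDerivAt X (rotorCircuit K M ε ρ (X t)) t) (hε : ε ≠ 0)
    (hρ : ρ ≠ 0) {t : ℝ} (hc : X t 2 ≠ 0) :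
    HasDerivAt (fun s => (1 - X s 4 * X s 4) / 2
        - K / 2 * (X s 0 * X s 3 * (ρ ^ 2 * (X s 2)⁻¹) * X s 4))
      (-(K / 2) * X t 4 * (X t 0 ^ 2 + X t 3 ^ 2)
        - K / 2 * ((-(ε * X t 0 * X t 1 * X t 3 + ρ ^ 2 * exp (-M) * X t 0 * X t 2 * X t 3
            + K * X t 0 * X t 3 * X t 4) * (ρ ^ 2 * (X t 2)⁻¹)
          - X t 0 * X t 3 * (ρ ^ 2 * (X t 2)⁻¹) *
            ((ρ ^ 2 * exp (-M) * X t 0 ^ 2 + ε⁻¹ * M * X t 1 * X t 2) * (X t 2)⁻¹)))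
          * X t 4
        - K ^ 2 / 2 * (X t 0 * X t 3 * (ρ ^ 2 * (X t 2)⁻¹)) * X t 3 ^ 2) t := by
  have hEE := ((hasDerivAt_e hX t).fun_mul (hasDerivAt_e hX t)).const_sub 1 |>.div_const 2
  have hVE := ((hasDerivAt_V hX hε hρ hc).fun_mul (hasDerivAt_e hX t)).const_mul (K / 2)
  refine (hEE.fun_sub hVE).congr_deriv ?_
  ring

/-- Dissipation inequality for `E_*` on `[t', 2]`, `t' = t_c + δ + 1/K`, `δ = 880 log K/M`:
`∂ₜE_* + Kã(t')E_* ≤ 7K⁻⁸⁹`. [cite: Tao2016AveragedNS, §5.5 (proof of (beable))] -/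
theorem Es_dissipation (hX : ∀ t, HasDerivAt X (rotorCircuit K M ε ρ (X t)) t)
    (h0 : X 0 = delayInit)
    (hε : 0 < ε) (hε1 : ε ≤ 1) (hρ : 0 < ρ) (hρε : ρ ^ 2 ≤ ε) (hM0 : 0 < M) (hMK : M ≤ K ^ 10)
    (hK : 16 ≤ K) (hεK : ε ^ 2 ≤ 1 / (6 * K ^ 20)) (hMρ : M * ρ ^ 4 ≤ ε ^ 2)
    (hε100 : ε ≤ 1 / K ^ 100)
    (hρexp : ρ ^ 4 ≤ ε ^ 2 * exp (-(18 * M)) / (64 * M)) (hδ : 0 ≤ δ)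
    (hon : K ^ 110 ≤ exp (M * δ / 8))
    (hτ1 : 1 ≤ τ) (hfit : τ + δ + (sqrt K)⁻¹ ≤ 2)
    (hcτ : ∀ t, 0 ≤ t → t ≤ τ → X t 2 ≤ ρ ^ 2 / K ^ 10) (hcτeq : X τ 2 = ρ ^ 2 / K ^ 10)
    {s : ℝ} (hs : s ∈ Icc (τ + δ + K⁻¹) 2) :
    (-(K / 2) * X s 4 * (X s 0 ^ 2 + X s 3 ^ 2)
        - K / 2 * ((-(ε * X s 0 * X s 1 * X s 3 + ρ ^ 2 * exp (-M) * X s 0 * X s 2 * X s 3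
            + K * X s 0 * X s 3 * X s 4) * (ρ ^ 2 * (X s 2)⁻¹)
          - X s 0 * X s 3 * (ρ ^ 2 * (X s 2)⁻¹) *
            ((ρ ^ 2 * exp (-M) * X s 0 ^ 2 + ε⁻¹ * M * X s 1 * X s 2) * (X s 2)⁻¹)))
          * X s 4
        - K ^ 2 / 2 * (X s 0 * X s 3 * (ρ ^ 2 * (X s 2)⁻¹)) * X s 3 ^ 2)
      + K * X (τ + δ + K⁻¹) 4 * ((1 - X s 4 * X s 4) / 2
        - K / 2 * (X s 0 * X s 3 * (ρ ^ 2 * (X s 2)⁻¹) * X s 4)) ≤ 7 / K ^ 89 := by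
  have hK0 : 0 < K := by linarith
  have hK1 : 1 ≤ K := by linarith
  have hτ2 : τ ≤ 2 := by linarith [inv_nonneg.2 (sqrt_nonneg K)]
  have hu0' : 0 < K⁻¹ := inv_pos.2 hK0
  have hsI : s ∈ Icc (τ + δ) 2 := ⟨by linarith [hs.1], hs.2⟩
  have hs02 : s ∈ Icc (0 : ℝ) 2 := ⟨by linarith [hs.1], hs.2⟩
  have hcl : K ^ 100 * ρ ^ 2 ≤ X s 2 :=
      c_large hX h0 hε hρ hρε hM0 hK hεK hMρ hρexp hδ hon hτ1 hτ2 hcτ hcτeq hsI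
  have hcpos : 0 < X s 2 := lt_of_lt_of_le (by positivity) hcl
  have hq0 : 0 ≤ ρ ^ 2 * (X s 2)⁻¹ := by positivity
  have hq1 : ρ ^ 2 * (X s 2)⁻¹ ≤ 1 / K ^ 100 := by
    rw [← div_eq_mul_inv, div_le_div_iff₀ hcpos (by positivity), one_mul]; linarith
  obtain ⟨hb5, hc5⟩ := bc_small hX h0 hε hρ hρε hM0.le hs02
  have hb2 : X s 1 ^ 2 ≤ (5 * ε) ^ 2 := by
    rw [← sq_abs]; exact pow_le_pow_left₀ (abs_nonneg _) hb5 2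
  have hc2 : X s 2 ^ 2 ≤ (5 * ε) ^ 2 := by
    rw [← sq_abs]; exact pow_le_pow_left₀ (abs_nonneg _) hc5 2
  have hmonoE := rotorCircuit_output_monotone hK0.le hX
  exact Es_alg hK (traj_sum_sq_eq_one hX h0 s) hq0 hq1
    (V_remainder_le hX h0 hε hε1 hρ hρε hM0 hMK hK hεK hMρ hρexp hδ hon hτ1 hτ2 hcτ hcτeq hsI)
    (traj_abs_le_one hX h0 s 0) (traj_abs_le_one hX h0 s 3) (traj_abs_le_one hX h0 s 4)
    (e_nonneg hX h0 hK0.le (by linarith))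
    ((le_abs_self _).trans (traj_abs_le_one hX h0 _ 4)) (hmonoE hs.1) hb2 hc2 hε hε1 hε100





/-- On `I = [t_c + δ, 2]`: `|½K·V·ã| ≤ ½K⁻⁹⁹` (`V = adρ²/c`, `ρ²/c ≤ K⁻¹⁰⁰`).
[cite: Tao2016AveragedNS, §5.5 (proof of (beable))] -/
theorem KVe_small (hX : ∀ t, HasDerivAt X (rotorCircuit K M ε ρ (X t)) t) (h0 : X 0 = delayInit)
    (hε : 0 < ε) (hρ : 0 < ρ) (hρε : ρ ^ 2 ≤ ε) (hM0 : 0 < M) (hK : 16 ≤ K)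
    (hεK : ε ^ 2 ≤ 1 / (6 * K ^ 20)) (hMρ : M * ρ ^ 4 ≤ ε ^ 2)
    (hρexp : ρ ^ 4 ≤ ε ^ 2 * exp (-(18 * M)) / (64 * M)) (hδ : 0 ≤ δ)
    (hon : K ^ 110 ≤ exp (M * δ / 8))
    (hτ1 : 1 ≤ τ) (hτ2 : τ ≤ 2)
    (hcτ : ∀ t, 0 ≤ t → t ≤ τ → X t 2 ≤ ρ ^ 2 / K ^ 10) (hcτeq : X τ 2 = ρ ^ 2 / K ^ 10)
    {s : ℝ} (hs : s ∈ Icc (τ + δ) 2) :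
    |K / 2 * (X s 0 * X s 3 * (ρ ^ 2 * (X s 2)⁻¹) * X s 4)| ≤ 1 / 2 / K ^ 99 := by
  have hK0 : 0 < K := by linarith
  have hcl : K ^ 100 * ρ ^ 2 ≤ X s 2 :=
    c_large hX h0 hε hρ hρε hM0 hK hεK hMρ hρexp hδ hon hτ1 hτ2 hcτ hcτeq hs
  have hcpos : 0 < X s 2 := lt_of_lt_of_le (by positivity) hcl
  have hq0 : 0 ≤ ρ ^ 2 * (X s 2)⁻¹ := by positivity
  have hq : ρ ^ 2 * (X s 2)⁻¹ ≤ 1 / K ^ 100 := by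
    rw [← div_eq_mul_inv, div_le_div_iff₀ hcpos (by positivity), one_mul]; linarith
  rw [abs_mul, abs_of_pos (by positivity : 0 < K / 2), abs_mul, abs_mul, abs_mul,
    abs_of_nonneg hq0]
  calc K / 2 * (|X s 0| * |X s 3| * (ρ ^ 2 * (X s 2)⁻¹) * |X s 4|)
      ≤ K / 2 * (1 * 1 * (1 / K ^ 100) * 1) := by
        refine mul_le_mul_of_nonneg_left ?_ (by positivity)
        exact mul_le_mul (mul_le_mul (mul_le_mul (traj_abs_le_one hX h0 s 0)
          (traj_abs_le_one hX h0 s 3) (abs_nonneg _) zero_le_one) hq hq0 (by norm_num))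
          (traj_abs_le_one hX h0 s 4) (abs_nonneg _) (by positivity)
    _ = 1 / 2 / K ^ 99 := by field_simp

/-- **(toke)**: on `[σ + 1/√K, 2]` (`σ = t_c + δ`),
`E_*(t) ≤ e^{-Kã(t')(t-t')} + 7K⁻⁸⁹/(Kã(t')) ≤ e^{(1-√K)/10} + 70K⁻⁹⁰` (Grönwall from
`t' = σ + 1/K`, `ã(t') ≥ 1/10`). [cite: Tao2016AveragedNS, §5.5 (toke)] -/
theorem Es_decay (hX : ∀ t, HasDerivAt X (rotorCircuit K M ε ρ (X t)) t) (h0 : X 0 = delayInit)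
    (hε : 0 < ε) (hε1 : ε ≤ 1) (hρ : 0 < ρ) (hρε : ρ ^ 2 ≤ ε) (hM0 : 0 < M) (hMK : M ≤ K ^ 10)
    (hK : 16 ≤ K) (hεK : ε ^ 2 ≤ 1 / (6 * K ^ 20)) (hMρ : M * ρ ^ 4 ≤ ε ^ 2)
    (hε100 : ε ≤ 1 / K ^ 100)
    (hρexp : ρ ^ 4 ≤ ε ^ 2 * exp (-(18 * M)) / (64 * M)) (hδ : 0 ≤ δ)
    (hon : K ^ 110 ≤ exp (M * δ / 8))
    (hτ1 : 1 ≤ τ) (hfit : τ + δ + (sqrt K)⁻¹ ≤ 2)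
    (hcτ : ∀ t, 0 ≤ t → t ≤ τ → X t 2 ≤ ρ ^ 2 / K ^ 10) (hcτeq : X τ 2 = ρ ^ 2 / K ^ 10)
    {t : ℝ} (ht : t ∈ Icc (τ + δ + 1 / sqrt K) 2) :
    (1 - X t 4 * X t 4) / 2 - K / 2 * (X t 0 * X t 3 * (ρ ^ 2 * (X t 2)⁻¹) * X t 4)
      ≤ exp ((1 - sqrt K) / 10) + 70 / K ^ 90 := by
  have hK0 : 0 < K := by linarith
  have hK1 : 1 ≤ K := by linarith
  obtain ⟨hs0, hs4, hKs, h4, hKs2⟩ := invSqrt_facts hK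
  have hτ2 : τ ≤ 2 := by linarith
  have hu0' : 0 < K⁻¹ := inv_pos.2 hK0
  have he₀ : 1 / 10 ≤ X (τ + δ + K⁻¹) 4 :=
      e_tenth hX h0 hε hε1 hρ hρε hM0 hMK hK hεK hMρ hρexp hδ hon hτ1 hfit hcτ hcτeq
  have he₀pos : 0 < X (τ + δ + K⁻¹) 4 := lt_of_lt_of_le (by norm_num) he₀
  have hKe : 0 < K * X (τ + δ + K⁻¹) 4 := mul_pos hK0 he₀pos
  have hKinv : K⁻¹ ≤ (sqrt K)⁻¹ := by
    rw [inv_le_inv₀ hK0 (by positivity)]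
    calc sqrt K ≤ sqrt K * sqrt K := le_mul_of_one_le_right (by positivity) (by linarith)
      _ = K := mul_self_sqrt hK0.le
  have ht't : τ + δ + K⁻¹ ≤ t := by rw [one_div] at ht; linarith [ht.1]
  have hI : ∀ s ∈ Icc (τ + δ + K⁻¹) 2, s ∈ Icc (τ + δ) 2 := fun s hs =>
    ⟨by linarith [hs.1], hs.2⟩
  have hC0 : 0 ≤ 7 / K ^ 89 / (K * X (τ + δ + K⁻¹) 4) := by positivity
  -- Grönwall in integrating-factor form
  have hanti := antitoneOn_intFactor (s := Icc (τ + δ + K⁻¹) 2)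
    (f := fun s => (1 - X s 4 * X s 4) / 2 - K / 2 * (X s 0 * X s 3 * (ρ ^ 2 * (X s 2)⁻¹) * X s 4))
    (g := fun _ => -(K * X (τ + δ + K⁻¹) 4)) (G := fun s => -(K * X (τ + δ + K⁻¹) 4 * s))
    (φ := fun s => 7 / K ^ 89 * exp (K * X (τ + δ + K⁻¹) 4 * s))
    (Φ := fun s => 7 / K ^ 89 / (K * X (τ + δ + K⁻¹) 4) * exp (K * X (τ + δ + K⁻¹) 4 * s))
    (convex_Icc _ 2)
    (fun s hs => by
      have hsI := hI s hs
      have hcl : K ^ 100 * ρ ^ 2 ≤ X s 2 :=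
        c_large hX h0 hε hρ hρε hM0 hK hεK hMρ hρexp hδ hon hτ1 hτ2 hcτ hcτeq hsI
      have hcne : X s 2 ≠ 0 := (lt_of_lt_of_le (by positivity) hcl).ne'
      exact hasDerivAt_Es hX hε.ne' hρ.ne' hcne)
    (fun s _ => ((hasDerivAt_id s).const_mul (K * X (τ + δ + K⁻¹) 4)).neg.congr_deriv (by simp))
    (fun s _ => by
      have hne : K * X (τ + δ + K⁻¹) 4 ≠ 0 := hKe.ne'
      have := (((hasDerivAt_id s).const_mul (K * X (τ + δ + K⁻¹) 4)).exp).const_mul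
        (7 / K ^ 89 / (K * X (τ + δ + K⁻¹) 4))
      refine this.congr_deriv ?_
      simp only [mul_one, id_eq]
      generalize X (τ + δ + K⁻¹) 4 = e₀ at hne ⊢
      have hne' : e₀ ≠ 0 := right_ne_zero_of_mul hne
      field_simp)
    (fun s hs => by
      have hdis := Es_dissipation hX h0 hε hε1 hρ hρε hM0 hMK hK hεK hMρ hε100 hρexp hδ hon hτ1 hfit
          hcτ hcτeq hs
      have hE : exp (-(-(K * X (τ + δ + K⁻¹) 4 * s))) = exp (K * X (τ + δ + K⁻¹) 4 * s) := by
        rw [neg_neg]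
      rw [hE]
      have h2 := mul_le_mul_of_nonneg_right hdis (exp_pos (K * X (τ + δ + K⁻¹) 4 * s)).le
      linarith)
  have ht'mem : τ + δ + K⁻¹ ∈ Icc (τ + δ + K⁻¹) 2 :=
    ⟨le_rfl, by linarith⟩
  have htmem : t ∈ Icc (τ + δ + K⁻¹) 2 := ⟨ht't, ht.2⟩
  have hA := hanti ht'mem htmem ht't
  simp only [neg_neg] at hA
  have hsplit : exp (K * X (τ + δ + K⁻¹) 4 * (τ + δ + K⁻¹))
      = exp (K * X (τ + δ + K⁻¹) 4 * t) * exp (K * X (τ + δ + K⁻¹) 4 * ((τ + δ + K⁻¹) - t)) := by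
    rw [← exp_add]; congr 1; ring
  rw [hsplit] at hA
  -- `E_*(t') ≤ 1`
  have hEs1 : (1 - X (τ + δ + K⁻¹) 4 * X (τ + δ + K⁻¹) 4) / 2
      - K / 2 * (X (τ + δ + K⁻¹) 0 * X (τ + δ + K⁻¹) 3 * (ρ ^ 2 * (X (τ + δ + K⁻¹) 2)⁻¹) * X (τ + δ
          + K⁻¹) 4)
      ≤ 1 := by
    have h1 : (1 - X (τ + δ + K⁻¹) 4 * X (τ + δ + K⁻¹) 4) / 2 ≤ 1 / 2 := by
      nlinarith [mul_self_nonneg (X (τ + δ + K⁻¹) 4)]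
    have h2 := (abs_le.1 (KVe_small hX h0 hε hρ hρε hM0 hK hεK hMρ hρexp hδ hon hτ1 hτ2 hcτ hcτeq
      (hI _ ht'mem))).1
    have h3 : 1 / 2 / K ^ 99 ≤ 1 / 2 := by
      rw [div_le_iff₀ (by positivity)]
      have : (1 : ℝ) ≤ K ^ 99 := one_le_pow₀ hK1
      linarith
    linarith
  have hr0 : 0 < exp (K * X (τ + δ + K⁻¹) 4 * ((τ + δ + K⁻¹) - t)) := exp_pos _
  have hEst := decay_alg (exp_pos _) hr0 hC0 hEs1 hA
  -- `r ≤ exp((1 - √K)/10)`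
  have hrle : exp (K * X (τ + δ + K⁻¹) 4 * ((τ + δ + K⁻¹) - t)) ≤ exp ((1 - sqrt K) / 10) := by
    rw [exp_le_exp]
    have h1 : K * X (τ + δ + K⁻¹) 4 * ((τ + δ + K⁻¹) - t) ≤ K * (1 / 10) * ((τ + δ + K⁻¹) - t) := by
      have hn : (τ + δ + K⁻¹) - t ≤ 0 := by linarith
      have := mul_le_mul_of_nonpos_right (mul_le_mul_of_nonneg_left he₀ hK0.le) hn
      linarith
    have h2 : K * (1 / 10) * ((τ + δ + K⁻¹) - t) ≤ K * (1 / 10) * (K⁻¹ - (sqrt K)⁻¹) := by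
      refine mul_le_mul_of_nonneg_left ?_ (by positivity)
      rw [one_div] at ht; linarith [ht.1]
    have h3 : K * (1 / 10) * (K⁻¹ - (sqrt K)⁻¹) = (1 - sqrt K) / 10 := by
      have : K * (sqrt K)⁻¹ = sqrt K := hKs
      have hKK : K * K⁻¹ = 1 := mul_inv_cancel₀ hK0.ne'
      calc K * (1 / 10) * (K⁻¹ - (sqrt K)⁻¹) = (K * K⁻¹ - K * (sqrt K)⁻¹) / 10 := by ring
        _ = (1 - sqrt K) / 10 := by rw [this, hKK]
    linarith
  have hCle : 7 / K ^ 89 / (K * X (τ + δ + K⁻¹) 4) ≤ 70 / K ^ 90 := by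
    rw [div_le_div_iff₀ hKe (by positivity)]
    calc 7 / K ^ 89 * K ^ 90 = 7 * K := by field_simp
      _ = 70 * (K * (1 / 10)) := by ring
      _ ≤ 70 * (K * X (τ + δ + K⁻¹) 4) := by
          have := mul_le_mul_of_nonneg_left he₀ hK0.le
          linarith
  linarith

/-- **(toke) ⇒ (beable), core estimate**: on `[σ + 1/√K, 2]`, `a² + d² ≤ 142K⁻²⁰`
(`a² + d² = 2E_* + KVã - b² - c²`). [cite: Tao2016AveragedNS, §5.5 (beable)] -/
theorem ad_small_late (hX : ∀ t, HasDerivAt X (rotorCircuit K M ε ρ (X t)) t) (h0 : X 0 = delayInit)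
    (hε : 0 < ε) (hε1 : ε ≤ 1) (hρ : 0 < ρ) (hρε : ρ ^ 2 ≤ ε) (hM0 : 0 < M) (hMK : M ≤ K ^ 10)
    (hK : 16 ≤ K) (hεK : ε ^ 2 ≤ 1 / (6 * K ^ 20)) (hMρ : M * ρ ^ 4 ≤ ε ^ 2)
    (hε100 : ε ≤ 1 / K ^ 100)
    (hρexp : ρ ^ 4 ≤ ε ^ 2 * exp (-(18 * M)) / (64 * M)) (hδ : 0 ≤ δ)
    (hon : K ^ 110 ≤ exp (M * δ / 8))
    (hN4 : 2 * exp ((1 - sqrt K) / 10) ≤ 1 / K ^ 20)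
    (hτ1 : 1 ≤ τ) (hfit : τ + δ + (sqrt K)⁻¹ ≤ 2)
    (hcτ : ∀ t, 0 ≤ t → t ≤ τ → X t 2 ≤ ρ ^ 2 / K ^ 10) (hcτeq : X τ 2 = ρ ^ 2 / K ^ 10)
    {t : ℝ} (ht : t ∈ Icc (τ + δ + 1 / sqrt K) 2) : X t 0 ^ 2 + X t 3 ^ 2 ≤ 142 / K ^ 20 := by
  have hK0 : 0 < K := by linarith
  have hK1 : 1 ≤ K := by linarith
  obtain ⟨hs0, hs4, hKs, h4, hKs2⟩ := invSqrt_facts hK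
  have hτ2 : τ ≤ 2 := by linarith
  have htI : t ∈ Icc (τ + δ) 2 := ⟨by rw [one_div] at ht; linarith [ht.1], ht.2⟩
  have hEs :=
      Es_decay hX h0 hε hε1 hρ hρε hM0 hMK hK hεK hMρ hε100 hρexp hδ hon hτ1 hfit hcτ hcτeq ht
  have hVt :=
      (abs_le.1 (KVe_small hX h0 hε hρ hρε hM0 hK hεK hMρ hρexp hδ hon hτ1 hτ2 hcτ hcτeq htI)).2
  have hsum := traj_sum_sq_eq_one hX h0 t
  have h99 : 1 / 2 / K ^ 99 ≤ 1 / 2 / K ^ 20 := by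
    apply div_le_div_of_nonneg_left (by norm_num) (by positivity)
    exact pow_le_pow_right₀ hK1 (by norm_num)
  have h90 : 70 / K ^ 90 ≤ 70 / K ^ 20 := by
    apply div_le_div_of_nonneg_left (by norm_num) (by positivity)
    exact pow_le_pow_right₀ hK1 (by norm_num)
  have hexp20 : exp ((1 - sqrt K) / 10) ≤ 1 / 2 / K ^ 20 := by
    have h := hN4
    rw [div_div, le_div_iff₀ (by positivity)]
    rw [le_div_iff₀ (by positivity)] at h
    linarith
  -- express everything in the single atom `w = (K²⁰)⁻¹`
  have hw1 : (1 : ℝ) / 2 / K ^ 20 = 1 / 2 * (K ^ 20)⁻¹ := by ring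
  have hw2 : (70 : ℝ) / K ^ 20 = 70 * (K ^ 20)⁻¹ := by ring
  have hw3 : (142 : ℝ) / K ^ 20 = 142 * (K ^ 20)⁻¹ := by ring
  rw [hw3]
  rw [hw1] at hexp20 h99
  rw [hw2] at h90
  have hee : X t 4 * X t 4 = X t 4 ^ 2 := by ring
  linarith [sq_nonneg (X t 1), sq_nonneg (X t 2)]

/-- **(beable), squared form**: for `t ≥ t_c + 1/√K`, `a² + b² + c² + d² ≤ 143K⁻²⁰` (on `[·,2]` from
`ad_small_late` and `b, c = O(ε)`; for `t ≥ 2` by monotonicity of `ã` and (energy-con)).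
[cite: Tao2016AveragedNS, §5.5 (beable)] -/
theorem late_sum_sq (hX : ∀ t, HasDerivAt X (rotorCircuit K M ε ρ (X t)) t) (h0 : X 0 = delayInit)
    (hε : 0 < ε) (hε1 : ε ≤ 1) (hρ : 0 < ρ) (hρε : ρ ^ 2 ≤ ε) (hM0 : 0 < M) (hMK : M ≤ K ^ 10)
    (hK : 16 ≤ K) (hεK : ε ^ 2 ≤ 1 / (6 * K ^ 20)) (hMρ : M * ρ ^ 4 ≤ ε ^ 2)
    (hε100 : ε ≤ 1 / K ^ 100)
    (hρexp : ρ ^ 4 ≤ ε ^ 2 * exp (-(18 * M)) / (64 * M)) (hδ : 0 ≤ δ)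
    (hon : K ^ 110 ≤ exp (M * δ / 8))
    (hN4 : 2 * exp ((1 - sqrt K) / 10) ≤ 1 / K ^ 20)
    (hτ1 : 1 ≤ τ) (hfit : τ + δ + (sqrt K)⁻¹ ≤ 2)
    (hcτ : ∀ t, 0 ≤ t → t ≤ τ → X t 2 ≤ ρ ^ 2 / K ^ 10) (hcτeq : X τ 2 = ρ ^ 2 / K ^ 10)
    {t : ℝ} (ht : τ + δ + 1 / sqrt K ≤ t) :
    X t 0 ^ 2 + X t 1 ^ 2 + X t 2 ^ 2 + X t 3 ^ 2 ≤ 143 / K ^ 20 := by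
  have hK0 : 0 < K := by linarith
  have hK1 : 1 ≤ K := by linarith
  obtain ⟨hs0, hs4, hKs, h4, hKs2⟩ := invSqrt_facts hK
  -- `b² + c² ≤ K⁻²⁰` on `[0,2]`
  have hbc : ∀ s ∈ Icc (0 : ℝ) 2, X s 1 ^ 2 + X s 2 ^ 2 ≤ 1 / K ^ 20 := by
    intro s hs
    obtain ⟨hb5, hc5⟩ := bc_small hX h0 hε hρ hρε hM0.le hs
    have hb2 : X s 1 ^ 2 ≤ (5 * ε) ^ 2 := by
      rw [← sq_abs]; exact pow_le_pow_left₀ (abs_nonneg _) hb5 2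
    have hc2 : X s 2 ^ 2 ≤ (5 * ε) ^ 2 := by
      rw [← sq_abs]; exact pow_le_pow_left₀ (abs_nonneg _) hc5 2
    have hεε : ε ^ 2 ≤ ε := by
      calc ε ^ 2 = ε * ε := sq ε
        _ ≤ ε * 1 := mul_le_mul_of_nonneg_left hε1 hε.le
        _ = ε := mul_one ε
    have h50 : 50 * (1 / K ^ 100) ≤ 1 / K ^ 20 := by
      rw [mul_one_div, div_le_div_iff₀ (by positivity) (by positivity), one_mul]
      have h80 : (50 : ℝ) ≤ K ^ 80 := by
        have : (16 : ℝ) ^ 80 ≤ K ^ 80 := pow_le_pow_left₀ (by norm_num) hK 80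
        linarith
      calc (50 : ℝ) * K ^ 20 ≤ K ^ 80 * K ^ 20 := mul_le_mul_of_nonneg_right h80 (by positivity)
        _ = K ^ 100 := by ring
    have : (5 * ε) ^ 2 = 25 * ε ^ 2 := by ring
    linarith [hεε.trans hε100]
  have hle2 : ∀ s, τ + δ + 1 / sqrt K ≤ s → s ≤ 2 →
      X s 0 ^ 2 + X s 1 ^ 2 + X s 2 ^ 2 + X s 3 ^ 2 ≤ 143 / K ^ 20 := by
    intro s hs1 hs2
    have had :=
      ad_small_late hX h0 hε hε1 hρ hρε hM0 hMK hK hεK hMρ hε100 hρexp hδ hon hN4 hτ1 hfit hcτ hcτeq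
      ⟨hs1, hs2⟩
    have hs0 : 0 ≤ s := by rw [one_div] at hs1; linarith
    have := hbc s ⟨hs0, hs2⟩
    have : 142 / K ^ 20 + 1 / K ^ 20 = 143 / K ^ 20 := by ring
    linarith
  by_cases h2 : t ≤ 2
  · exact hle2 t ht h2
  · -- `t > 2`: monotonicity of `ã` from time `2`
    have h2' : 2 < t := not_le.1 h2
    have hτs : τ + δ + 1 / sqrt K ≤ 2 := by rw [one_div]; linarith
    have hS2 := hle2 2 hτs le_rfl
    have hsum2 := traj_sum_sq_eq_one hX h0 2
    have hsumt := traj_sum_sq_eq_one hX h0 t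
    have hmonoE := rotorCircuit_output_monotone hK0.le hX
    have he2t : X 2 4 ≤ X t 4 := hmonoE h2'.le
    have he20 : 0 ≤ X 2 4 := e_nonneg hX h0 hK0.le (by norm_num)
    have hsq : X 2 4 ^ 2 ≤ X t 4 ^ 2 := pow_le_pow_left₀ he20 he2t 2
    linarith

end Summit.NavierStokesRegularity.FluidComputer.RotorKnob
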